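import Literature.AnabelianGeometry.EtaleTheta.Discharge.Sec2Cor218ivLiftingDY
import Literature.AnabelianGeometry.EtaleTheta.ThetaRigidityLevelsHeisenbergWitness
import HarnessLib

/-!
# [EtTh] Cor. 2.18 (iv) at the DISCRETE HEISENBERG SKELETON of `(Π^tp_X)^Θ`: BOTH typed clauses hold —
# fibres by `D_Y ↦ D_Y`, surjectivity by the `D_Y`-aware lift (proof-only)

S. Mochizuki, *The Étale Theta Function …* [EtTh], Publ. RIMS **45** (2009), §1 p. 35, §2 Def. 2.13 p. 47,
Prop. 2.14 (i) p. 49, Cor. 2.18 (iv) pp. 61–63 (locators `p.N` = PDF pages; bib key `MochizukiEtTh2009`).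

PROOF-ONLY sequel (no `def`, no instance, no new named fact; cell `abc-iut`, seat abc-iut-f-151, tranche
151, rows F-0638 `ThetaEnvData.Cor218_iv_fibre` / F-0639 `ThetaEnvData.Cor218_iv_surjective`) of
`ThetaRigidityLevelsHeisenbergWitness.lean` (fibre clause only).  Same toy — `Π^tp_X := ℤ² ⋊ ℤ`, the
discrete Heisenberg group `⟨a, b, c | [a, b] = c central⟩`, `Π^tp_Y := ⟨b, c⟩ ≅ ℤ²` abelian,
`Π^tp_Ÿ := ⟨b², c⟩`, `G_K := 1`, `μ_3`, `η₀ : bᵝ cᵞ ↦ γ mod 3` — and now ALSO the surjectivity clause: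

**`exists_cor218_iv_fibre_and_surjective_of_DY`**: `|μ| = 3`, `Π^tp_Y` commutative, `D_Y ≠ 1`, and both
`Cor218_iv_fibre` and `Cor218_iv_surjective` hold.  SURJECTIVITY: an automorphism `γ` of `Π^tp_X`
preserving `Π^tp_Y` maps the central `c` to `c^{t}` (`t = ±1`) and `b` to `bᵖ c^{q}`; it lifts to the model
automorphism `(u, bᵝ cᵞ) ↦ (uᵗ · ζ^{−qβ}, γ(bᵝ cᵞ))`, whose homomorphism part `bᵝ cᵞ ↦ ζ^{−qβ}` is
conjugation invariant, so the lift normalises `D_Y = ⟨[conj_a]⟩` (abc-iut-f-151's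
`exists_iso_over_of_coeff_hom_conj`).  Together with w5-d175's abelian toys this closes the census of
[EtTh] Cor. 2.18 (iv)'s two typed clauses at toy scale: they hold jointly with a nontrivial cyclotome both
at a non-abelian `Π^tp_Y` with `D_Y = 1` (`ThetaRigidityLevelsDihedralWitness`) and at the faithful
abelian-`Π^tp_Y` skeleton with `D_Y ≠ 1` (here), and fail separately exactly where print's mechanisms
are absent.

HONEST FRAMING: a statement about the cell's own typing at one explicit toy; nothing here bears on [EtTh]
(refereed) or on [IUTchIII] Cor. 3.12; no side taken; typed ≠ proved.
-/

namespace Literature.AnabelianGeometry.EtaleTheta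

namespace ThetaEnvData

open RigidData.ToyN3 (M3)

/-- **F-0638 ∧ F-0639 at the Heisenberg skeleton.**  There is a `ThetaEnvData` at level `3` —
`Π^tp_X := ℤ² ⋊ ℤ` (`a · (β, γ) · a⁻¹ = (β, γ + β)`), `G_K := 1`, `Π^tp_Y := ℤ²`, `Π^tp_Ÿ := ⟨b², c⟩`,
`μ_3`, `η₀ = γ mod 3` — with `|μ| = 3`, `Π^tp_Y` commutative, `D_Y ≠ 1`, at which BOTH `Cor218_iv_fibre`
(rigidity by `D_Y ↦ D_Y`) AND `Cor218_iv_surjective` (the `D_Y`-aware lift `(u, bᵝcᵞ) ↦ (uᵗ ζ^{−qβ}, γ(bᵝcᵞ))`)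
hold. [cite: MochizukiEtTh2009, Cor 2.18(iv) p.61] -/
theorem exists_cor218_iv_fibre_and_surjective_of_DY :
    ∃ T : ThetaEnvData.{0} 3, Fintype.card T.mu = 3 ∧ (∀ x y : T.PiY, x * y = y * x) ∧ T.DY ≠ ⊥ ∧
      Literature.AnabelianGeometry.EtaleTheta.ThetaEnvData.Cor218_iv_fibre T ∧
      Literature.AnabelianGeometry.EtaleTheta.ThetaEnvData.Cor218_iv_surjective T := by
  classical
  -- the lattice `ℤ² = ⟨b, c⟩` (written multiplicatively) and the unipotent `u : (β, γ) ↦ (β, γ + β)`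
  let V : Type := Multiplicative (ℤ × ℤ)
  let uA : ℤ × ℤ ≃+ ℤ × ℤ :=
    { toFun := fun v => (v.1, v.2 + v.1)
      invFun := fun v => (v.1, v.2 - v.1)
      left_inv := fun v => by ext <;> simp
      right_inv := fun v => by ext <;> simp
      map_add' := fun v w => by ext <;> simp only [Prod.fst_add, Prod.snd_add]; ring }
  let u : V ≃* V := AddEquiv.toMultiplicative uA
  let φ : Multiplicative ℤ →* MulAut V := zpowersHom (MulAut V) u
  -- every `φ g = u^k` preserves the `b`-coordinate and fixes the `c`-line
  have huA : ∀ v : V, Multiplicative.toAdd (u v) =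
      ((Multiplicative.toAdd v).1, (Multiplicative.toAdd v).2 + (Multiplicative.toAdd v).1) := fun v => rfl
  let S : Subgroup (MulAut V) :=
    { carrier := {e | (∀ v, (Multiplicative.toAdd (e v)).1 = (Multiplicative.toAdd v).1) ∧
        ∀ t : ℤ, e (Multiplicative.ofAdd ((0 : ℤ), t)) = Multiplicative.ofAdd ((0 : ℤ), t)}
      mul_mem' := fun {e e'} he he' => ⟨fun v => by
          change (Multiplicative.toAdd (e (e' v))).1 = _
          rw [he.1, he'.1], fun t => by
          change e (e' _) = _
          rw [he'.2, he.2]⟩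
      one_mem' := ⟨fun v => rfl, fun t => rfl⟩
      inv_mem' := fun {e} he => ⟨fun v => by
          have h := he.1 (e⁻¹ v)
          rw [MulAut.apply_inv_self] at h
          exact h.symm, fun t => by
          have h := congrArg (fun v => e⁻¹ v) (he.2 t)
          simp only [MulAut.inv_apply_self] at h
          exact h.symm⟩ }
  have huS : u ∈ S := ⟨fun v => rfl, fun t => by
    apply Multiplicative.toAdd.injective
    rw [huA, toAdd_ofAdd]
    simp⟩
  have hφS : ∀ g : Multiplicative ℤ, φ g ∈ S := fun g => by
    change u ^ (Multiplicative.toAdd g) ∈ S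
    exact S.zpow_mem huS _
  have hφ1 : ∀ (g : Multiplicative ℤ) (v : V),
      (Multiplicative.toAdd (φ g v)).1 = (Multiplicative.toAdd v).1 := fun g => (hφS g).1
  have hφ2 : ∀ (g : Multiplicative ℤ) (t : ℤ),
      φ g (Multiplicative.ofAdd ((0 : ℤ), t)) = Multiplicative.ofAdd ((0 : ℤ), t) := fun g => (hφS g).2
  -- the Heisenberg group `Π := ℤ² ⋊ ℤ`, discrete
  let P : Type := V ⋊[φ] Multiplicative ℤ
  letI : TopologicalSpace P := ⊥
  haveI : DiscreteTopology P := ⟨rfl⟩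
  let PiY : Subgroup P := (SemidirectProduct.rightHom : P →* Multiplicative ℤ).ker
  have mem_PiY : ∀ x : P, x ∈ PiY ↔ x.right = 1 := fun x => Iff.rfl
  -- `β mod 2`, a homomorphism on all of `Π` (the `b`-coordinate is additive on `Π`)
  let L : P →* Multiplicative (ZMod 2) :=
    { toFun := fun x => Multiplicative.ofAdd (((Multiplicative.toAdd x.left).1 : ℤ) : ZMod 2)
      map_one' := by simp
      map_mul' := fun x y => by
        rw [SemidirectProduct.mul_left, toAdd_mul, Prod.fst_add, hφ1, Int.cast_add, ofAdd_add] }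
  let PiYdd : Subgroup P := L.ker ⊓ PiY
  let b₀ : V := Multiplicative.ofAdd ((1 : ℤ), (0 : ℤ))
  let c₀ : V := Multiplicative.ofAdd ((0 : ℤ), (1 : ℤ))
  let a : P := SemidirectProduct.inr (Multiplicative.ofAdd (1 : ℤ))
  have hinl_mem : ∀ v : V, (SemidirectProduct.inl v : P) ∈ PiY := fun v => by
    rw [mem_PiY, SemidirectProduct.right_inl]
  have hc_dd : (SemidirectProduct.inl c₀ : P) ∈ PiYdd := by
    refine ⟨?_, hinl_mem c₀⟩
    change L (SemidirectProduct.inl c₀) = 1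
    simp [L, c₀]
  -- `a b a⁻¹ = b c`
  have hφa : φ (Multiplicative.ofAdd (1 : ℤ)) = u := by
    change u ^ Multiplicative.toAdd (Multiplicative.ofAdd (1 : ℤ)) = u
    rw [toAdd_ofAdd, zpow_one]
  have hub : u b₀ = b₀ * c₀ := rfl
  have haba : a * SemidirectProduct.inl b₀ * a⁻¹ =
      (SemidirectProduct.inl b₀ * SemidirectProduct.inl c₀ : P) := by
    rw [← map_inv, ← SemidirectProduct.inl_aut, hφa, hub, map_mul]
  have hmul_left : ∀ x y : P, x ∈ PiY → (x * y).left = x.left * y.left := fun x y hx => by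
    rw [SemidirectProduct.mul_left, (mem_PiY x).mp hx, map_one, MulAut.one_apply]
  have index_PiYdd : (PiYdd.subgroupOf PiY).index = 2 := by
    change PiYdd.relIndex PiY = 2
    rw [Subgroup.inf_relIndex_right, Subgroup.relIndex_ker]
    have hmap : PiY.map L = ⊤ := by
      have key : ∀ t : Multiplicative (ZMod 2), t = 1 ∨ t = Multiplicative.ofAdd 1 := by decide
      refine top_le_iff.mp fun t _ => ?_
      rcases key t with rfl | rfl
      · exact ⟨1, PiY.one_mem, map_one L⟩
      · exact ⟨SemidirectProduct.inl b₀, hinl_mem b₀, by simp [L, b₀]⟩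
    rw [hmap, Subgroup.card_top, Nat.card_eq_fintype_card]
    rfl
  haveI hPiYdd_normal : PiYdd.Normal := inferInstance
  let q : P → M3 := fun x => Multiplicative.ofAdd (((Multiplicative.toAdd x.left).2 : ℤ) : ZMod 3)
  have q_mul : ∀ x y : P, x ∈ PiY → q (x * y) = q x * q y := fun x y hx => by
    change Multiplicative.ofAdd ((((Multiplicative.toAdd (x * y).left).2 : ℤ) : ZMod 3)) = _
    rw [hmul_left x y hx, toAdd_mul, Prod.snd_add, Int.cast_add, ofAdd_add]
  let η₀ : PiYdd → M3 := fun y => q y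
  let T : ThetaEnvData.{0} 3 :=
    { PiX := P
      G := PUnit
      aug := 1
      aug_surjective := fun _ => ⟨1, Subsingleton.elim _ _⟩
      PiY := PiY
      PiY_normal := MonoidHom.normal_ker _
      PiY_open := isOpen_discrete _
      galYX := QuotientGroup.quotientKerEquivOfSurjective _ SemidirectProduct.rightHom_surjective
      PiYdd := PiYdd
      PiYdd_le := inf_le_right
      PiYdd_normal := hPiYdd_normal
      PiYdd_open := isOpen_discrete _
      index_PiYdd := index_PiYdd
      mu := M3
      mu_cyclic := inferInstance
      card_mu := rfl
      chi := 1
      chi_ker_open := isOpen_discrete _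
      thetaCocycles := {η₀}
      thetaCocycles_nonempty := Set.singleton_nonempty _
      isCocycle := by
        rintro η hη
        rw [Set.mem_singleton_iff] at hη
        subst hη
        intro x y
        change q ((x : P) * y) = q x * q y
        exact q_mul x y x.2.2
      locallyConstant := fun η _ => IsLocallyConstant.of_discrete η
      mul_coboundary_mem := by
        rintro η hη c
        rw [Set.mem_singleton_iff] at hη ⊢
        subst hη
        funext x
        simp [CycEnvelope.coboundary] }
  haveI hG : Subsingleton T.G := inferInstanceAs (Subsingleton PUnit)
  -- an element of `Π_Y` IS `inl` of its left coordinate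
  have hinl : ∀ y : P, y ∈ PiY → SemidirectProduct.inl y.left = y := fun y hy =>
    SemidirectProduct.ext (by simp) (by rw [SemidirectProduct.right_inl, (mem_PiY y).mp hy])
  -- `inl (β, δ) = b^β c^δ`
  have hv : ∀ β δ : ℤ, (SemidirectProduct.inl (Multiplicative.ofAdd (β, δ)) : P) =
      SemidirectProduct.inl b₀ ^ β * SemidirectProduct.inl c₀ ^ δ := by
    intro β δ
    rw [← map_zpow (SemidirectProduct.inl : V →* P), ← map_zpow (SemidirectProduct.inl : V →* P),
      ← map_mul]
    congr 1
    apply Multiplicative.toAdd.injective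
    rw [toAdd_ofAdd, toAdd_mul, toAdd_zpow, toAdd_zpow]
    ext <;> simp [b₀, c₀]
  -- the `c`-line is central
  have hc_central : ∀ (t : ℤ) (w : P),
      SemidirectProduct.inl (Multiplicative.ofAdd ((0 : ℤ), t)) * w =
        w * SemidirectProduct.inl (Multiplicative.ofAdd ((0 : ℤ), t)) := by
    intro t w
    refine SemidirectProduct.ext ?_ ?_
    · rw [SemidirectProduct.mul_left, SemidirectProduct.mul_left, SemidirectProduct.left_inl,
        SemidirectProduct.right_inl, map_one, MulAut.one_apply, hφ2, mul_comm]
    · rw [SemidirectProduct.mul_right, SemidirectProduct.mul_right, SemidirectProduct.right_inl,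
        one_mul, mul_one]
  -- an element commuting with `a` has trivial `b`-coordinate
  have hcomm_a : ∀ z : P, z * a = a * z → (Multiplicative.toAdd z.left).1 = 0 := by
    intro z h
    have h1 : z.left = u z.left := by
      have h' := congrArg SemidirectProduct.left h
      rw [SemidirectProduct.mul_left, SemidirectProduct.mul_left, SemidirectProduct.left_inr,
        SemidirectProduct.right_inr, map_one, mul_one, one_mul, hφa] at h'
      exact h'
    have h2 := congrArg (fun v : V => (Multiplicative.toAdd v).2) h1
    change (Multiplicative.toAdd z.left).2 =
      (Multiplicative.toAdd z.left).2 + (Multiplicative.toAdd z.left).1 at h2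
    omega
  -- STRUCTURE OF THE AUTOMORPHISMS PRESERVING `Π_Y`: `e(b^β c^δ) = b^{βp} c^{βq + δt}`
  have key : ∀ e : P ≃ₜ* P, (∀ g : P, g ∈ PiY → e g ∈ PiY) →
      ∃ p' q' t : ℤ, ∀ β δ : ℤ, e (SemidirectProduct.inl (Multiplicative.ofAdd (β, δ))) =
        SemidirectProduct.inl (Multiplicative.ofAdd (β * p', β * q' + δ * t)) := by
    intro e he
    -- `e b = b^p c^q`
    have hb := hinl _ (he _ (hinl_mem b₀))
    -- `e c` is central, hence on the `c`-line
    have hcen : ∀ w : P, e (SemidirectProduct.inl c₀) * w = w * e (SemidirectProduct.inl c₀) := by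
      intro w
      have h := congrArg e (hc_central 1 (e.symm w))
      rw [map_mul, map_mul, ContinuousMulEquiv.apply_symm_apply] at h
      exact h
    have hc1 : (Multiplicative.toAdd (e (SemidirectProduct.inl c₀)).left).1 = 0 :=
      hcomm_a _ (hcen a)
    have hc := hinl _ (he _ (hinl_mem c₀))
    refine ⟨(Multiplicative.toAdd (e (SemidirectProduct.inl b₀)).left).1,
      (Multiplicative.toAdd (e (SemidirectProduct.inl b₀)).left).2,
      (Multiplicative.toAdd (e (SemidirectProduct.inl c₀)).left).2, fun β δ => ?_⟩
    rw [hv, map_mul, map_zpow, map_zpow, ← hb, ← hc, ← map_zpow, ← map_zpow, ← map_mul]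
    congr 1
    apply Multiplicative.toAdd.injective
    rw [toAdd_mul, toAdd_zpow, toAdd_zpow, toAdd_ofAdd]
    ext
    · simp only [Prod.fst_add, Prod.smul_fst, smul_eq_mul, hc1, mul_zero, add_zero,
        SemidirectProduct.left_inl]
    · simp only [Prod.snd_add, Prod.smul_snd, smul_eq_mul, SemidirectProduct.left_inl]
  have hY_comm : ∀ x y : T.PiY, x * y = y * x := by
    rintro ⟨x, hx⟩ ⟨y, hy⟩
    apply Subtype.ext
    change x * y = y * x
    refine SemidirectProduct.ext ?_ ?_
    · rw [hmul_left x y hx, hmul_left y x hy, mul_comm]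
    · rw [SemidirectProduct.mul_right, SemidirectProduct.mul_right, (mem_PiY x).mp hx,
        (mem_PiY y).mp hy]
  refine ⟨T, rfl, hY_comm, fun hD => ?_, ?_, ?_⟩
  · -- `D_Y ≠ 1`: `[conj_a]` is not inner, since the envelope `μ_3 × Π_Y` is abelian and `a b a⁻¹ ≠ b`
    have hmem := T.mk_conjX_mem_DY a
    rw [hD, Subgroup.mem_bot] at hmem
    have hmem' : (⟨T.conjX a, T.conjX_mem_contMulAut a⟩ : contMulAut T.env) ∈ innerContAut T.env :=
      (QuotientGroup.eq_one_iff _).mp hmem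
    obtain ⟨e, he⟩ := (Subgroup.mem_subgroupOf.mp hmem' : _)
    have henv_comm : ∀ x y : T.env, x * y = y * x := fun x y =>
      SemidirectProduct.ext (by rw [T.mul_left_eq, T.mul_left_eq, mul_comm]) (by
        rw [SemidirectProduct.mul_right, SemidirectProduct.mul_right, hY_comm])
    have he' : MulAut.conj e = T.conjX a := he
    have hconj1 : T.conjX a = 1 := by
      rw [← he']
      refine MulEquiv.ext fun x => ?_
      rw [MulAut.conj_apply, henv_comm e x, mul_inv_cancel_right]
      rfl
    have h1 := congrArg (fun F : MulAut T.env =>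
      (((F (CycEnvelope.algSection T.augY T.chi ⟨SemidirectProduct.inl b₀, hinl_mem b₀⟩)).right
        : T.PiY) : P)) hconj1
    change a * SemidirectProduct.inl b₀ * a⁻¹ = SemidirectProduct.inl b₀ at h1
    rw [haba, ← map_mul] at h1
    have h2 : b₀ * c₀ = b₀ * 1 := (SemidirectProduct.inl_injective h1).trans (mul_one b₀).symm
    have h3 : c₀ = 1 := mul_left_cancel h2
    have h4 := congrArg (fun v : V => (Multiplicative.toAdd v).2) h3
    simp [c₀] at h4
  · -- the fibre clause, by the `D_Y`-aware rigidity criterion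
    refine T.cor218_iv_fibre_of_coeff_rigid_conj fun η hη ψ f hf hfinv => ?_
    have h1 : η = η₀ := hη
    subst h1
    -- invariance under `a`: `f(b c) = f(a b a⁻¹) = f(b)`, so `f(c) = 1`
    let yb : T.PiY := ⟨SemidirectProduct.inl b₀, hinl_mem b₀⟩
    let yc : T.PiY := ⟨SemidirectProduct.inl c₀, hinl_mem c₀⟩
    have hconj : (⟨a * (yb : T.PiX) * a⁻¹, T.PiY_normal.conj_mem _ yb.2 a⟩ : T.PiY) = yb * yc :=
      Subtype.ext haba
    have hfc : f yc = 1 := by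
      have h := hfinv a yb
      rw [hconj, map_mul] at h
      exact mul_eq_left.mp h
    -- on `Π_Ÿ ∋ c`: `f(c) = ψ(ζ) · ζ⁻¹`, and `η₀(c) = ζ`
    have hζ : ψ (Multiplicative.ofAdd (1 : ZMod 3) : M3) = (Multiplicative.ofAdd (1 : ZMod 3) : M3) := by
      have h := hf ⟨SemidirectProduct.inl c₀, hc_dd⟩
      have hq : η₀ ⟨SemidirectProduct.inl c₀, hc_dd⟩ = (Multiplicative.ofAdd (1 : ZMod 3) : M3) := by
        change q (SemidirectProduct.inl c₀) = _
        simp [q, c₀]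
      rw [hq] at h
      have hyc : T.inclYdd ⟨SemidirectProduct.inl c₀, hc_dd⟩ = yc := rfl
      rw [hyc, hfc] at h
      exact ((eq_mul_inv_iff_mul_eq.mp h).symm.trans (one_mul _))
    exact M3.mulEquiv_eq_refl_of_apply_zeta ψ hζ
  · -- the surjectivity clause, by the `D_Y`-aware lifting criterion
    intro η hη γ hγ
    have h1 : η = η₀ := hη
    subst h1
    -- transport of membership along `γ`, `γ⁻¹`
    have hY : ∀ g : P, g ∈ PiY → γ g ∈ PiY := fun g hg => hγ.le ⟨g, hg, rfl⟩
    have hY' : ∀ g : P, g ∈ PiY → γ.symm g ∈ PiY := fun g hg => by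
      have hg' : g ∈ Subgroup.map γ.toMulEquiv.toMonoidHom T.PiY := by rw [hγ]; exact hg
      obtain ⟨g₀, hg₀, hg₀eq⟩ := hg'
      have : γ.symm g = g₀ := by rw [← hg₀eq]; exact γ.symm_apply_apply g₀
      rw [this]; exact hg₀
    obtain ⟨p', q', t, hγinl⟩ := key γ hY
    obtain ⟨p'', q'', t', hγinl'⟩ := key γ.symm hY'
    -- `t t' = 1`, so `t = ±1`
    have htt : t * t' = 1 := by
      have h := γ.symm_apply_apply (SemidirectProduct.inl c₀)
      have hc0 : (SemidirectProduct.inl c₀ : P) = SemidirectProduct.inl (Multiplicative.ofAdd ((0:ℤ), (1:ℤ))) := rfl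
      rw [hc0, hγinl, hγinl'] at h
      have h2 := congrArg (fun x : P => (Multiplicative.toAdd x.left).2) h
      simp only [SemidirectProduct.left_inl, toAdd_ofAdd] at h2
      -- h2 : (0 * p') * q'' + (0 * q' + 1 * t) * t' = 1
      have : t * t' = (0 * p') * q'' + (0 * q' + 1 * t) * t' := by ring
      rw [this, h2]
    have ht : t = 1 ∨ t = -1 := Int.eq_one_or_neg_one_of_mul_eq_one htt
    have htt' : t * t = 1 := by rcases ht with rfl | rfl <;> norm_num
    -- membership in `Π_Ÿ`: `inl (β, δ)` with `β` even
    have mem_dd : ∀ β δ : ℤ, (SemidirectProduct.inl (Multiplicative.ofAdd (β, δ)) : P) ∈ PiYdd ↔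
        ((β : ℤ) : ZMod 2) = 0 := by
      intro β δ
      change (L _ = 1 ∧ _ ∈ PiY) ↔ _
      simp only [hinl_mem, and_true]
      change Multiplicative.ofAdd (((Multiplicative.toAdd
        (SemidirectProduct.inl (Multiplicative.ofAdd (β, δ)) : P).left).1 : ℤ) : ZMod 2) = 1 ↔ _
      rw [SemidirectProduct.left_inl, toAdd_ofAdd]
      exact ofAdd_eq_one
    have hdd_of : ∀ (e : P ≃ₜ* P) (pe qe te : ℤ),
        (∀ β δ : ℤ, e (SemidirectProduct.inl (Multiplicative.ofAdd (β, δ))) =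
          SemidirectProduct.inl (Multiplicative.ofAdd (β * pe, β * qe + δ * te))) →
        ∀ g : P, g ∈ PiYdd → e g ∈ PiYdd := by
      intro e pe qe te he g hg
      have hg' : g = SemidirectProduct.inl (Multiplicative.ofAdd
          ((Multiplicative.toAdd g.left).1, (Multiplicative.toAdd g.left).2)) := (hinl g hg.2).symm
      have hβ : (((Multiplicative.toAdd g.left).1 : ℤ) : ZMod 2) = 0 := by
        rw [hg'] at hg
        exact (mem_dd _ _).mp hg
      rw [hg', he, mem_dd]
      push_cast
      rw [hβ, zero_mul]
    have hdd : ∀ g : P, g ∈ T.PiYdd → γ g ∈ T.PiYdd := hdd_of γ p' q' t hγinl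
    have hdd' : ∀ g : P, g ∈ T.PiYdd → γ.symm g ∈ T.PiYdd := hdd_of γ.symm p'' q'' t' hγinl'
    -- the `b`-coordinate as a homomorphism on `Π`, and the homomorphism part `f = ζ^{-q β}`
    let B : P →* Multiplicative ℤ :=
      { toFun := fun x => Multiplicative.ofAdd (Multiplicative.toAdd x.left).1
        map_one' := by simp
        map_mul' := fun x y => by
          rw [SemidirectProduct.mul_left, toAdd_mul, Prod.fst_add, hφ1, ofAdd_add] }
    let fZ : Multiplicative ℤ →* M3 :=
      { toFun := fun z => Multiplicative.ofAdd (((-(q' * Multiplicative.toAdd z)) : ℤ) : ZMod 3)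
        map_one' := by simp
        map_mul' := fun z w => by
          rw [← ofAdd_add, toAdd_mul]
          push_cast
          ring_nf }
    let f : T.PiY →* T.mu := fZ.comp (B.comp T.PiY.subtype)
    have hf_apply : ∀ y : T.PiY, f y =
        Multiplicative.ofAdd (((-(q' * (Multiplicative.toAdd (y : P).left).1)) : ℤ) : ZMod 3) :=
      fun y => rfl
    have hfinv : ∀ (g : T.PiX) (y : T.PiY),
        f ⟨g * (y : T.PiX) * g⁻¹, T.PiY_normal.conj_mem _ y.2 g⟩ = f y := by
      intro g y
      change fZ (B (g * (y : P) * g⁻¹)) = fZ (B y)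
      rw [map_mul, map_mul, map_inv, map_mul, map_mul, map_inv]
      exact mul_inv_cancel_comm _ _
    -- the coefficient automorphism `ψ = (·)^t`
    let ψ : M3 ≃* M3 := MonoidHom.toMulEquiv (zpowGroupHom t) (zpowGroupHom t)
      (by ext m; simp [← zpow_mul, htt']) (by ext m; simp [← zpow_mul, htt'])
    have hψ_apply : ∀ m : M3, ψ m = m ^ t := fun m => rfl
    refine T.exists_iso_over_of_coeff_hom_conj hη γ hY hY' hdd hdd' ψ f
      continuous_of_discreteTopology hfinv fun y => ?_
    -- the relation `ψ (η₀ y) = f(y) · η₀ (γ y)` on `Π_Ÿ`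
    have hyY : (y : P) ∈ PiY := y.2.2
    have hy' : (y : P) = SemidirectProduct.inl (Multiplicative.ofAdd
        ((Multiplicative.toAdd (y : P).left).1, (Multiplicative.toAdd (y : P).left).2)) :=
      (hinl _ hyY).symm
    have hγy := hγinl (Multiplicative.toAdd (y : P).left).1 (Multiplicative.toAdd (y : P).left).2
    rw [← hy'] at hγy
    have hq1 : q (y : P) = Multiplicative.ofAdd (((Multiplicative.toAdd (y : P).left).2 : ℤ) : ZMod 3) :=
      rfl
    have hq2 : q (γ (y : P)) = Multiplicative.ofAdd
        ((((Multiplicative.toAdd (y : P).left).1 * q' + (Multiplicative.toAdd (y : P).left).2 * t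
          : ℤ) : ZMod 3)) := by
      rw [hγy]
      rfl
    have hfy : f (T.inclYdd y) =
        Multiplicative.ofAdd (((-(q' * (Multiplicative.toAdd (y : P).left).1)) : ℤ) : ZMod 3) := rfl
    show ψ (q (y : P)) = f (T.inclYdd y) * q (γ (y : P))
    rw [hψ_apply, hfy, hq1, hq2, ← ofAdd_zsmul, ← ofAdd_add]
    congr 1
    simp only [zsmul_eq_mul]
    push_cast
    ring

end ThetaEnvData

end Literature.AnabelianGeometry.EtaleTheta
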